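import Summits.HodgeConjecture.HodgeConjecture.Theorems.F0P3cStCharTSShellKit            -- ★ p848983 (LH6-p02): `smoothTrace_shell_eq_mul_sum` (★ R2d Casselman shell form at `m = 1` + ★ LEVEL-DEPTH + TMULT); brings ★ R2d `exists_isLeftTransversal_conj`
import Summits.HodgeConjecture.HodgeConjecture.Theorems.F0P3cStCharTSStShellTrace        -- ★ p849965 (LH6-p02): `measureReal_doubleCoset_eq_card_mul` (`μ(K b K) = #R · μ(K)`)
import Summits.HodgeConjecture.HodgeConjecture.Theorems.F0P3cStCharTSConstants           -- ★ p850178 (F0P2-p06): `natCast_card_ne_zero_of_isLeftTransversal`, `ofReal_measureReal_coe_subgroup_ne_zero`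
import Literature.NumberTheory.Rogawski1990.LocalTransferFundamentalLemma                 -- ★ `IsLocSmooth`, `isLocSmooth_indicator`
import HarnessLib

/-!
# F0 · P3c · line LH6 «StCharTS» — «CASSELMAN-CAP★»: the character of an admissible representation at a dominant torus element IS the character of its Jacquet
# module there, `χ_π(b) = χ_{π_N}(b)` — the pointwise form of Casselman's theorem from the Hecke-shell form ★ R2d [Casselman1977, Thm. 5.2; Rogawski1990, §12.7 p. 193]

Cell `pub/hodgecm-mathlib`, crux H413 = `stmt-HodgeConjecture-24833` (`--supports`, helper lane), route HCCMUnconditional; seat LH6-p05 (g3), on the (TOR)-road integrator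
LH6-p01 (g3)'s ruling 2026-09-02T09:07:11Z «(F-a) CASSELMAN-5.2: ≠ as a named fact, = as a theorem — ★ R2d + a cap in `Theorems/`».  GENERIC `G` (no CM carrier).  THEOREMS
ONLY, sorry-free, ★-only imports, no definition ∕ instance ∕ notation ∕ named fact.

THE MATHEMATICS.  `G` a topological group with a Haar measure `μ`, `ρ` an admissible representation on `V` with finite-dimensional Jacquet module `V_N` for the parabolic
triple `t = (P, M, N)` (`N` closed; `G` Hausdorff) whose `π_N`-trace is the sum of the characters of a multiset `s` (★ «TMULT» shape), `𝓘` an Iwahori datum for `t`, `b ∈ M` commuting with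
`M` and DOMINANT at every level (F1-G's `hbN ∕ hbNbar ∕ hbexh`), and `Θ : G → ℂ` a function REPRESENTING the trace of `ρ` on `C_c^∞` (`Tr ρ(φ) = ∫ φ·Θ dμ`) that is LOCALLY
CONSTANT AT `b` (Harish-Chandra: `b` regular).  THEN `Θ(b) = Σ_{θ ∈ s} θ(b) = tr π_N(b)` (`character_eq_sum_exponents_of_dominant`).  Proof: shrink the Hecke shell
`K_n b K_n` into the constancy neighbourhood of `b` (continuity of `(k, k′) ↦ k b k′`, ★ `hasBasis_K`) AND below the depth of ★ LEVEL-DEPTH; then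
`∫ 𝟙_{K_n b K_n}·Θ dμ = μ(K_n b K_n)·Θ(b) = #R·μ(K_n)·Θ(b)` (★ `measureReal_doubleCoset_eq_card_mul`) while ★ `smoothTrace_shell_eq_mul_sum` (★ R2d
`Representation.smoothTrace_indicator_shell_eq` at `m = 1`) gives `Tr ρ(𝟙_{K_n b K_n}) = μ(K_n)·#R·Σ_θ θ(b)`; cancel `μ(K_n)·#R ≠ 0` (★ ⑦ CONSTANTS).  Print: «by Casselman's
theorem, `χ_π(γ) = χ_{π_N}(γ)`» [Rogawski1990, L. 12.7.2 proof p. 193]; «`tr π(f) = tr π_N(f̄^P)`» [Casselman1977, Thm. 5.2].  CM USE (the (L1M) half of (TOR⁗), integrator's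
road): `Θ := 𝔇.char σ` with (M1) (local constancy on `G^r`, trace representation), `b := ι u` dominant (★ «DOM-BRIDGE» `dominant_torusChart_of_levels`, `M_T` abelian),
`s` := ★ TMULT of `σ`; then `Δ(ι u)·χ_σ(ι u) = Δ(ι u)·Σ θ_i(ι u)` pointwise off `M_c`, and square-integrability (★ `norm_exponent_lt_one_of_isSquareIntegrableModCenter`) makes it
summable over the shells.
HONEST LABEL: count-neutral; HC_CM is proved only modulo the 7 printed citations (2 remaining: hLiu418 = stmt-HodgeConjecture-24832, h413 = stmt-HodgeConjecture-24833)
until rung 0 closes.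

## References
* [Casselman1977] W. Casselman, *Characters and Jacquet modules*, Math. Ann. 230 (1977), Thm. 5.2.
* [Rogawski1990] J. D. Rogawski, *Automorphic Representations of Unitary Groups in Three Variables*, Ann. of Math. Stud. 123 (1990), §12.7 L. 12.7.2 (proof) p. 193.
* [Casselman1995] W. Casselman, *Introduction to the theory of admissible representations of p-adic reductive groups* (1995 notes), §4.1, Prop. 4.1.6, §1.5 Lemma 1.5.1.
-/

set_option autoImplicit false
-- the mandated namespace has the single-problem summit's repeated segment (`HodgeConjecture.HodgeConjecture`)
set_option linter.dupNamespace false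

noncomputable section

open MeasureTheory MeasureTheory.Measure Topology Filter
open scoped Pointwise
open Literature.NumberTheory Literature.NumberTheory.Automorphic Literature.NumberTheory.Rogawski1990
open Summit.HodgeConjecture.HodgeConjecture.Cruxes.H413

namespace Summit.HodgeConjecture.HodgeConjecture.Cruxes.H413.F0P3cStCharTSCasselmanCap

variable {G : Type*} [Group G] [TopologicalSpace G] [IsTopologicalGroup G] [MeasurableSpace G] [BorelSpace G]

omit [MeasurableSpace G] [BorelSpace G] in
/-- **A HECKE SHELL SHRINKS TO ITS CENTRE**: for every neighbourhood `W` of `b` some level has `K_n b K_n ⊆ W` (continuity of `(k, k′) ↦ k b k′` at `(1, 1)`, ★ `hasBasis_K`),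
and the level can be taken inside any given neighbourhood `U` of `1`. [cite: Casselman1995, Prop. 1.4.4 p. 14] -/
theorem exists_level_doubleCoset_subset (t : ParabolicTriple G) (𝓘 : t.IwahoriDatum) (b : G) {W : Set G} (hW : W ∈ 𝓝 b) {U : Set G} (hU : U ∈ 𝓝 (1 : G)) :
    ∃ n : ℕ, (𝓘.K n : Set G) ⊆ U ∧ DoubleCoset.doubleCoset b (𝓘.K n : Set G) (𝓘.K n) ⊆ W := by
  have hcont : Continuous (fun p : G × G => p.1 * b * p.2) := (continuous_fst.mul continuous_const).mul continuous_snd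
  have hW' : W ∈ 𝓝 ((fun p : G × G => p.1 * b * p.2) ((1 : G), (1 : G))) := by simpa only [one_mul, mul_one] using hW
  obtain ⟨V₁, hV₁, V₂, hV₂, hVV⟩ := mem_nhds_prod_iff.1 (hcont.continuousAt.preimage_mem_nhds hW')
  obtain ⟨n, hn⟩ := 𝓘.hasBasis_K (U ∩ (V₁ ∩ V₂)) (inter_mem hU (inter_mem hV₁ hV₂))
  refine ⟨n, fun x hx => (hn hx).1, fun g hg => ?_⟩
  obtain ⟨x, hx, y, hy, rfl⟩ := DoubleCoset.mem_doubleCoset.1 hg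
  exact hVV (Set.mk_mem_prod (hn hx).2.1 (hn hy).2.2)

omit [Group G] [TopologicalSpace G] [IsTopologicalGroup G] [BorelSpace G] in
/-- **`∫ 𝟙_D · Θ dμ = μ(D) · Θ(b)`** when `Θ ≡ Θ(b)` on the measurable set `D`. [cite: Casselman1995, §1.5 Lemma 1.5.1] -/
theorem integral_indicator_mul_eq_of_eqOn (μ : Measure G) {D : Set G} (hD : MeasurableSet D) (Θ : G → ℂ) (b : G) (hΘ : ∀ g ∈ D, Θ g = Θ b) :
    ∫ g, D.indicator (fun _ => (1 : ℂ)) g * Θ g ∂μ = (μ.real D : ℂ) * Θ b := by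
  have hfun : (fun g => D.indicator (fun _ => (1 : ℂ)) g * Θ g) = D.indicator (fun _ => Θ b) := by
    funext g
    by_cases hg : g ∈ D
    · rw [Set.indicator_of_mem hg, Set.indicator_of_mem hg, one_mul, hΘ g hg]
    · rw [Set.indicator_of_notMem hg, Set.indicator_of_notMem hg, zero_mul]
  rw [hfun, integral_indicator_const _ hD, Complex.real_smul]

/-- **«CASSELMAN-CAP★» — `χ_π(b) = χ_{π_N}(b)` AT A DOMINANT TORUS ELEMENT, POINTWISE.**  `μ` Haar; `ρ` admissible with finite-dimensional Jacquet module whose `π_N`-trace is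
the multiset sum `Σ_{θ ∈ s} θ` (★ TMULT shape); `𝓘` an Iwahori datum; `b ∈ M` commuting with `M`, dominant at every level (F1-G shapes `hbN hbNbar hbexh`); `Θ` represents
`Tr ρ` on `C_c^∞(G)` and is locally constant at `b`.  Then `Θ b = Σ_{θ ∈ s} θ(b)`. [cite: Casselman1977, Thm. 5.2] [cite: Rogawski1990, §12.7 L. 12.7.2 (proof) p. 193]
[cite: Casselman1995, §4.1 Prop. 4.1.6] -/
theorem character_eq_sum_exponents_of_dominant [T2Space G] (μ : Measure G) [μ.IsHaarMeasure]
    {V : Type*} [AddCommGroup V] [Module ℂ V] {ρ : Representation ℂ G V} (hadm : ρ.IsAdmissible)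
    (t : ParabolicTriple G) (hN : IsClosed (t.N : Set G)) (𝓘 : t.IwahoriDatum) (hfd : FiniteDimensional ℂ (t.restrict ρ).Coinvariants)
    (s : Multiset (↥t.M →* ℂˣ)) (hs : ∀ m : ↥t.M, LinearMap.trace ℂ _ (ρ.jacquetModule t m) = (s.map fun θ : ↥t.M →* ℂˣ => ((θ m : ℂˣ) : ℂ)).sum)
    (Θ : G → ℂ) (htr : ∀ φ : G → ℂ, IsLocSmooth φ → ρ.smoothTrace μ φ = ∫ g, φ g * Θ g ∂μ)
    {b : G} (hbM : b ∈ t.M) (hbcomm : ∀ m ∈ t.M, m * b = b * m) (hbN : ∀ n, ∀ x ∈ 𝓘.K n ⊓ t.N, b * x * b⁻¹ ∈ 𝓘.K n)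
    (hbNbar : ∀ n, ∀ x ∈ 𝓘.K n ⊓ 𝓘.Nbar, b⁻¹ * x * b ∈ 𝓘.K n ⊓ 𝓘.Nbar)
    (hbexh : ∀ n, ∀ x ∈ t.N, ∃ m : ℕ, ∀ m', m ≤ m' → b ^ m' * x * (b ^ m')⁻¹ ∈ 𝓘.K n)
    (hloc : ∀ᶠ g in 𝓝 b, Θ g = Θ b) :
    Θ b = (s.map fun θ : ↥t.M →* ℂˣ => ((θ ⟨b, hbM⟩ : ℂˣ) : ℂ)).sum := by
  -- depth neighbourhood of ★ R2d ∕ LEVEL-DEPTH and the constancy neighbourhood of `Θ` at `b`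
  obtain ⟨U, hU, hshell⟩ := F0P3cStCharTSShellKit.smoothTrace_shell_eq_mul_sum μ hadm t hN 𝓘 hfd s hs hbM hbcomm hbN hbNbar hbexh
  obtain ⟨W, hW, hΘW⟩ := hloc.exists_mem
  obtain ⟨n, hnU, hnW⟩ := exists_level_doubleCoset_subset t 𝓘 b hW hU
  -- a transversal at that level; the two evaluations of `Tr ρ(𝟙_{K_n b K_n})`
  obtain ⟨R, hR⟩ := Representation.exists_isLeftTransversal_conj (𝓘.isCompact_K n) (𝓘.isOpen_K n) b
  have key := hshell n hnU R hR
  have hDo : IsOpen (DoubleCoset.doubleCoset b (𝓘.K n : Set G) (𝓘.K n)) := (𝓘.isOpen_K n).mul_left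
  have hDc : IsCompact (DoubleCoset.doubleCoset b (𝓘.K n : Set G) (𝓘.K n)) := ((𝓘.isCompact_K n).mul isCompact_singleton).mul (𝓘.isCompact_K n)
  rw [htr _ (isLocSmooth_indicator hDo hDc.isClosed hDc), integral_indicator_mul_eq_of_eqOn μ hDo.measurableSet Θ b (fun g hg => hΘW g (hnW hg)),
    F0P3cStCharTSStShellTrace.measureReal_doubleCoset_eq_card_mul μ (𝓘.isOpen_K n) b hR, Complex.ofReal_mul, Complex.ofReal_natCast] at key
  -- cancel `μ(K_n) · #R ≠ 0`
  have hK : ((μ.real (𝓘.K n : Set G) : ℝ) : ℂ) ≠ 0 :=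
    F0P3cStCharTSConstants.ofReal_measureReal_coe_subgroup_ne_zero μ (𝓘.K n) (𝓘.isOpen_K n) (𝓘.isCompact_K n)
  have hRc : (R.card : ℂ) ≠ 0 := F0P3cStCharTSConstants.natCast_card_ne_zero_of_isLeftTransversal hR
  have key' : ((μ.real (𝓘.K n : Set G) : ℂ) * (R.card : ℂ)) * Θ b =
      ((μ.real (𝓘.K n : Set G) : ℂ) * (R.card : ℂ)) * (s.map fun θ : ↥t.M →* ℂˣ => ((θ ⟨b, hbM⟩ : ℂˣ) : ℂ)).sum := by
    rw [← key]; ring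
  exact mul_left_cancel₀ (mul_ne_zero hK hRc) key'

end Summit.HodgeConjecture.HodgeConjecture.Cruxes.H413.F0P3cStCharTSCasselmanCap

end
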